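import Literature.NumberTheory.Transcendental.PadicCW77Setup
import Mathlib.NumberTheory.Height.NumberField
import HarnessLib

/-!
# From the `p`-adic core on a `Setup` to the symmetric bound for principal units

Support file (definitions and proved theorems; no named fact), sequel to `PadicCW77Setup.lean`
(cell `abc-stewartyu`, the wrapper of milestone M1's `stub_TheoremA`). The analytic core of the
`p`-adic Cijsouw–Waldschmidt / Waldschmidt descent (WP-A3…A5) is a statement about a
`S : PadicCW77.Setup` — an eliminated generator `θ` whose coefficient has MINIMAL `p`-adic order —
bounding `‖Λ₀‖_p` from below (`CoreBound C r`). The cell's milestone consumes the SYMMETRIC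
statement `SymmBound C r` (= the planner's `AbcStewartYuPlan.PadicCW77Bound C r` verbatim: `m`
principal units `αⱼ ≡ 1 (mod p)`, `b ≠ 0` arbitrary, `ord_p(∏ αⱼ^{bⱼ} − 1) · log p ≤ C(m) ∏Vⱼ
(W + log 2V_max) log(2V_max) / (log p)^{r(m)}`). This file proves
`symmBound_of_coreBound : CoreBound C r → SymmBound (2C) r` (for `C ≥ 2`, `r(m) ≤ m`):
choose for `θ` an index `i₀` with `b_{i₀} ≠ 0` of minimal `p`-adic order (Yu's normalisation),
re-index the others along `Fin.succAbove i₀`, transport the Kummer condition and the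
multiplicative independence along the equivalence `Fin (d+1) ≃ Fin (d+1)`
(`castSucc j ↦ i₀.succAbove j`, `last ↦ i₀`), and convert
`‖Θ − 1‖_p = ‖Λ‖_p = ‖b_θ‖_p ‖Λ₀‖_p > |b_θ|⁻¹ e^{−U} ≥ e^{−W} e^{−U}` into
`ord_p(Θ − 1) log p < U + W ≤ 2U`.

## References
* [Yu1990] K. Yu, *Linear forms in p-adic logarithms II*, Compositio Math. 74 (1990), Theorem 1
  (the normalisation `ord_p b_n = min ord_p bⱼ`).
* [Waldschmidt1980] M. Waldschmidt, Acta Arith. 37 (1980), §3.6 (p. 275: from Prop. 3.1 to 3.8).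
-/

noncomputable section

open NormedSpace Finset IsUltrametricDist Height
open scoped Nat

namespace Literature.NumberTheory.Transcendental

namespace PadicCW77

open CW77.Setup (Idx Tau tauNorm)

/-! ### The two statements -/

/-- **The core bound** (target of WP-A3/A4/A5): for every `Setup` whose generators are
multiplicatively independent and Kummer-free, with heights `h(αⱼ) ≤ Vⱼ`, `h(θ) ≤ V_θ`,
`log p ≤ Vⱼ, V_θ ≤ V_max`, coefficients `log max(3,|bⱼ|), log max(3,|b_θ|) ≤ W`:
`‖Λ₀‖_p > exp(−C(d+1) (∏Vⱼ · V_θ) (W + log 2V_max) log(2V_max) / (log p)^{r(d+1)})`.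
[cite: Yu1990, Theorem 1] [cite: Waldschmidt1980, Prop. 3.8 (p. 263)] -/
def CoreBound (C : ℕ → ℝ) (r : ℕ → ℕ) : Prop :=
  ∀ (S : Setup) (V : Fin S.d → ℝ) (Vθ Vmax W : ℝ),
    (∀ T : Finset (Fin (S.d + 1)), T.Nonempty → ¬ IsSquare (∏ i ∈ T, S.all i)) →
    (∀ μ : Fin (S.d + 1) → ℤ, ∏ i, S.all i ^ μ i = 1 → μ = 0) →
    (∀ j, logHeight₁ (S.α j) ≤ V j) → logHeight₁ S.θ ≤ Vθ →
    (∀ j, Real.log S.p ≤ V j) → Real.log S.p ≤ Vθ → (∀ j, V j ≤ Vmax) → Vθ ≤ Vmax →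
    (∀ j, Real.log (max 3 (|S.b j| : ℝ)) ≤ W) → Real.log (max 3 (|S.bθ| : ℝ)) ≤ W →
    Real.exp (-(C (S.d + 1) * ((∏ j, V j) * Vθ) * (W + Real.log (2 * Vmax)) *
      Real.log (2 * Vmax) / Real.log S.p ^ r (S.d + 1))) < ‖S.Λ₀‖

/-- **The symmetric bound for principal units** (verbatim the cell's `PadicCW77Bound C r`).
[cite: Yu1990, Theorem 1] -/
def SymmBound (C : ℕ → ℝ) (r : ℕ → ℕ) : Prop :=
  ∀ (p : ℕ), p.Prime → p ≠ 2 →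
    ∀ (m : ℕ) (α : Fin m → ℚ) (b : Fin m → ℤ) (V : Fin m → ℝ) (Vmax W : ℝ),
      (∀ j, α j ≠ 0 ∧ 1 ≤ padicValRat p (α j - 1)) →
      (∀ μ : Fin m → ℤ, ∏ j, α j ^ μ j = 1 → μ = 0) →
      (∀ T : Finset (Fin m), T.Nonempty → ¬ IsSquare (∏ j ∈ T, α j)) →
      (∀ j, logHeight₁ (α j) ≤ V j) → (∀ j, Real.log p ≤ V j) → (∀ j, V j ≤ Vmax) →
      b ≠ 0 → (∀ j, Real.log (max 3 (|b j| : ℝ)) ≤ W) →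
      (padicValRat p (∏ j, α j ^ b j - 1) : ℝ) * Real.log p ≤
        C m * (∏ j, V j) * (W + Real.log (2 * Vmax)) * Real.log (2 * Vmax) / Real.log p ^ r m

/-! ### The re-indexing equivalence -/

/-- The equivalence `Fin (d+1) ≃ Fin (d+1)`: `castSucc j ↦ i₀.succAbove j`, `last ↦ i₀`.
[cite: Yu1990, Theorem 1] -/
def reidxEquiv {d : ℕ} (i₀ : Fin (d + 1)) : Fin (d + 1) ≃ Fin (d + 1) :=
  (finSuccEquiv' (Fin.last d)).trans (finSuccEquiv' i₀).symm

/-- `reidxEquiv i₀ (castSucc j) = i₀.succAbove j`. [cite: Yu1990, Theorem 1] -/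
@[simp] theorem reidxEquiv_castSucc {d : ℕ} (i₀ : Fin (d + 1)) (j : Fin d) :
    reidxEquiv i₀ (Fin.castSucc j) = i₀.succAbove j := by
  unfold reidxEquiv
  rw [Equiv.trans_apply, ← Fin.succAbove_last, finSuccEquiv'_succAbove, finSuccEquiv'_symm_some]

/-- `reidxEquiv i₀ last = i₀`. [cite: Yu1990, Theorem 1] -/
@[simp] theorem reidxEquiv_last {d : ℕ} (i₀ : Fin (d + 1)) : reidxEquiv i₀ (Fin.last d) = i₀ := by
  unfold reidxEquiv
  rw [Equiv.trans_apply, finSuccEquiv'_at, finSuccEquiv'_symm_none]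

/-- `Fin.snoc (f ∘ succAbove i₀) (f i₀) = f ∘ reidxEquiv i₀`. [cite: Yu1990, Theorem 1] -/
theorem snoc_comp_succAbove {d : ℕ} {X : Type*} (f : Fin (d + 1) → X) (i₀ : Fin (d + 1)) (i : Fin (d + 1)) :
    (Fin.snoc (α := fun _ => X) (fun j => f (i₀.succAbove j)) (f i₀) : Fin (d + 1) → X) i =
      f (reidxEquiv i₀ i) := by
  refine Fin.lastCases ?_ (fun j => ?_) i
  · rw [Fin.snoc_last, reidxEquiv_last]
  · rw [Fin.snoc_castSucc, reidxEquiv_castSucc]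

/-! ### The wrapper -/

/-- **From the core to the symmetric bound.** [cite: Yu1990, Theorem 1]
[cite: Waldschmidt1980, §3.6 (p. 275)] -/
theorem symmBound_of_coreBound {C : ℕ → ℝ} {r : ℕ → ℕ} (hC : ∀ m, 1 ≤ m → 2 ≤ C m) (hr : ∀ m, r m ≤ m)
    (hcore : CoreBound C r) : SymmBound (fun m => 2 * C m) r := by
  intro p hp hp2 m α b V Vmax W hα hmult hK hV hVp hVmax hb hW
  classical
  haveI : Fact p.Prime := ⟨hp⟩
  have hp3 : 3 ≤ p := by
    have := hp.two_le; omega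
  -- `m = d + 1`
  obtain ⟨d, rfl⟩ : ∃ d, m = d + 1 := by
    rcases m with - | d
    · exact absurd (Subsingleton.elim b 0) hb
    · exact ⟨d, rfl⟩
  -- an index with `b ≠ 0` of minimal `p`-adic order
  set I : Finset (Fin (d + 1)) := univ.filter fun i => b i ≠ 0 with hI
  have hIne : I.Nonempty := by
    by_contra hne
    rw [Finset.not_nonempty_iff_eq_empty] at hne
    apply hb; funext i
    by_contra hbi
    have : i ∈ I := by rw [hI, mem_filter]; exact ⟨mem_univ _, hbi⟩
    rw [hne] at this; simp at this
  obtain ⟨i₀, hi₀I, hmin⟩ := I.exists_min_image (fun i => padicValInt p (b i)) hIne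
  have hbi₀ : b i₀ ≠ 0 := by rw [hI, mem_filter] at hi₀I; exact hi₀I.2
  -- the set-up
  let S : Setup :=
    { p := p, hp := hp, hp3 := hp3, d := d, α := fun j => α (i₀.succAbove j), θ := α i₀,
      b := fun j => b (i₀.succAbove j), bθ := b i₀, bθ_ne := hbi₀,
      hbmin := fun j hj => hmin _ (by rw [hI, mem_filter]; exact ⟨mem_univ _, hj⟩),
      hα := fun j => (hα _).2, hθ := (hα i₀).2 }
  -- `S.all = α ∘ e`
  have hall : ∀ i, S.all i = α (reidxEquiv i₀ i) := fun i => snoc_comp_succAbove α i₀ i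
  -- transport the Kummer condition
  have hK' : ∀ T : Finset (Fin (S.d + 1)), T.Nonempty → ¬ IsSquare (∏ i ∈ T, S.all i) := by
    intro T hT
    have e1 : ∏ i ∈ T, S.all i = ∏ j ∈ T.map (reidxEquiv i₀).toEmbedding, α j := by
      rw [Finset.prod_map]; exact prod_congr rfl fun i _ => hall i
    rw [e1]
    exact hK _ (by simpa using hT)
  -- transport the multiplicative independence
  have hmult' : ∀ μ : Fin (S.d + 1) → ℤ, ∏ i, S.all i ^ μ i = 1 → μ = 0 := by
    intro μ hμ
    have e1 : ∏ i, S.all i ^ μ i = ∏ j, α j ^ μ ((reidxEquiv i₀).symm j) := by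
      rw [← (reidxEquiv i₀).prod_comp (fun j => α j ^ μ ((reidxEquiv i₀).symm j))]
      exact prod_congr rfl fun i _ => by rw [hall, Equiv.symm_apply_apply]
    rw [e1] at hμ
    have h0 := hmult _ hμ
    funext i
    have := congrFun h0 (reidxEquiv i₀ i)
    simpa using this
  -- the core
  have hΛ₀ := hcore S (fun j => V (i₀.succAbove j)) (V i₀) Vmax W hK' hmult'
    (fun j => hV _) (hV i₀) (fun j => hVp _) (hVp i₀) (fun j => hVmax _) (hVmax i₀)
    (fun j => hW _) (hW i₀)
  -- `(∏ⱼ V(succAbove j)) · V i₀ = ∏ᵢ Vᵢ`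
  have hprodV : (∏ j : Fin d, V (i₀.succAbove j)) * V i₀ = ∏ i, V i := by
    rw [Fin.prod_univ_succAbove _ i₀, mul_comm]
  set U : ℝ := C (d + 1) * (∏ i, V i) * (W + Real.log (2 * Vmax)) * Real.log (2 * Vmax) /
    Real.log p ^ r (d + 1) with hU
  have hΛ₀' : Real.exp (-U) < ‖S.Λ₀‖ := by
    have : C (S.d + 1) * ((∏ j : Fin S.d, V (i₀.succAbove j)) * V i₀) *
        (W + Real.log (2 * Vmax)) * Real.log (2 * Vmax) / Real.log S.p ^ r (S.d + 1) = U := by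
      rw [hU]; change C (d + 1) * ((∏ j : Fin d, V (i₀.succAbove j)) * V i₀) * _ * _ / Real.log p ^ r (d + 1) = _
      rw [hprodV]
    rw [this] at hΛ₀; exact hΛ₀
  -- positivity bookkeeping
  have hlp : 1 < Real.log p := by
    rw [← Real.exp_lt_exp, Real.exp_log (by exact_mod_cast hp.pos)]
    refine lt_of_lt_of_le ?_ (by exact_mod_cast hp3 : (3 : ℝ) ≤ p)
    have := Real.exp_one_lt_d9; norm_num at this ⊢; linarith
  have hlp0 : 0 < Real.log p := by linarith
  have hVpos : ∀ i, 0 < V i := fun i => hlp0.trans_le (hVp i)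
  have hprodV1 : Real.log p ^ r (d + 1) ≤ ∏ i, V i := by
    calc Real.log p ^ r (d + 1) ≤ Real.log p ^ (d + 1) := pow_le_pow_right₀ hlp.le (hr _)
      _ = ∏ _i : Fin (d + 1), Real.log p := by simp
      _ ≤ ∏ i, V i := prod_le_prod (fun _ _ => hlp0.le) fun i _ => hVp i
  have hlog3 : 1 < Real.log 3 := by
    rw [Real.lt_log_iff_exp_lt (by norm_num)]
    have := Real.exp_one_lt_d9; linarith
  have hVmax3 : Real.log 3 ≤ Vmax := by
    calc Real.log 3 ≤ Real.log p := Real.log_le_log (by norm_num) (by exact_mod_cast hp3)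
      _ ≤ V i₀ := hVp i₀
      _ ≤ Vmax := hVmax i₀
  have hl2V : Real.log 2 ≤ Real.log (2 * Vmax) := by
    refine Real.log_le_log two_pos ?_
    linarith
  have hl2V0 : 0 < Real.log (2 * Vmax) := lt_of_lt_of_le (Real.log_pos one_lt_two) hl2V
  have hW3 : Real.log 3 ≤ W := le_trans (Real.log_le_log (by norm_num) (le_max_left _ _)) (hW i₀)
  have hW0 : 0 < W := by linarith
  have hP0 : 0 < ∏ i, V i := prod_pos fun i _ => hVpos i
  have hC0 : 0 ≤ C (d + 1) := by linarith [hC (d + 1) d.succ_pos]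
  have hU0 : 0 ≤ U := by
    rw [hU]
    exact div_nonneg (mul_nonneg (mul_nonneg (mul_nonneg hC0 hP0.le) (by linarith)) hl2V0.le)
      (pow_nonneg hlp0.le _)
  -- `W ≤ U`
  have hWU : W ≤ U := by
    rw [hU, le_div_iff₀ (pow_pos hlp0 _)]
    have h1 : W * Real.log p ^ r (d + 1) ≤ W * ∏ i, V i := mul_le_mul_of_nonneg_left hprodV1 hW0.le
    have h2 : W * ∏ i, V i ≤ C (d + 1) * (∏ i, V i) * (W + Real.log (2 * Vmax)) * Real.log (2 * Vmax) := by
      have hl2 : (1 : ℝ) / 2 < Real.log 2 := by have := Real.log_two_gt_d9; linarith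
      have hC2 := hC (d + 1) d.succ_pos
      -- `W ∏V ≤ 2 · ∏V · W · (1/2) ≤ C ∏V (W + log 2Vmax) log(2Vmax)`
      have : W ≤ C (d + 1) * (W + Real.log (2 * Vmax)) * Real.log (2 * Vmax) := by
        calc W = 2 * W * (1 / 2) := by ring
          _ ≤ C (d + 1) * (W + Real.log (2 * Vmax)) * Real.log (2 * Vmax) := by
              refine mul_le_mul (mul_le_mul hC2 (by linarith) hW0.le (by linarith)) (by linarith)
                (by norm_num) (by positivity)
      calc W * ∏ i, V i ≤ (C (d + 1) * (W + Real.log (2 * Vmax)) * Real.log (2 * Vmax)) * ∏ i, V i :=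
            mul_le_mul_of_nonneg_right this hP0.le
        _ = C (d + 1) * (∏ i, V i) * (W + Real.log (2 * Vmax)) * Real.log (2 * Vmax) := by ring
    exact h1.trans h2
  -- `Θ = ∏ αⱼ^{bⱼ}`
  have hΘ : S.Θ = ∏ j, α j ^ b j := by
    change (∏ j : Fin d, α (i₀.succAbove j) ^ b (i₀.succAbove j)) * α i₀ ^ b i₀ = _
    rw [Fin.prod_univ_succAbove _ i₀, mul_comm]
  -- the conclusion
  change (padicValRat p (∏ j, α j ^ b j - 1) : ℝ) * Real.log p ≤
    2 * C (d + 1) * (∏ j, V j) * (W + Real.log (2 * Vmax)) * Real.log (2 * Vmax) / Real.log p ^ r (d + 1)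
  have hRHS : 2 * C (d + 1) * (∏ j, V j) * (W + Real.log (2 * Vmax)) * Real.log (2 * Vmax) /
      Real.log p ^ r (d + 1) = 2 * U := by rw [hU]; ring
  rw [hRHS]
  by_cases hΘ1 : ∏ j, α j ^ b j = 1
  · rw [hΘ1, sub_self, padicValRat.zero]; simp; linarith
  -- `‖Θ − 1‖_p = p^{-v} = ‖b_θ‖ ‖Λ₀‖ > e^{-W} e^{-U}`
  have hΘ1' : (∏ j, α j ^ b j) - 1 ≠ 0 := sub_ne_zero.mpr hΘ1
  have hnorm : ‖(((∏ j, α j ^ b j) - 1 : ℚ) : ℚ_[p])‖ = (p : ℝ) ^ (-padicValRat p ((∏ j, α j ^ b j) - 1)) :=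
    S.norm_ratCast_eq hΘ1'
  have hnorm' : ‖(((∏ j, α j ^ b j) - 1 : ℚ) : ℚ_[p])‖ = ‖(S.bθ : ℚ_[S.p])‖ * ‖S.Λ₀‖ := by
    rw [← S.norm_Λ_eq_mul, S.norm_Λ, hΘ]; push_cast; rfl
  have hbθ : Real.exp (-W) ≤ ‖(S.bθ : ℚ_[S.p])‖ := by
    change Real.exp (-W) ≤ ‖((b i₀ : ℤ) : ℚ_[p])‖
    have habs0 : 0 < |(b i₀ : ℝ)| := abs_pos.mpr (by exact_mod_cast hbi₀)
    have h1 : (1 : ℝ) / |(b i₀ : ℝ)| ≤ ‖((b i₀ : ℤ) : ℚ_[p])‖ := one_div_le_norm_intCast hbi₀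
    have hle : |(b i₀ : ℝ)| ≤ Real.exp W := by
      have hlogb : Real.log |(b i₀ : ℝ)| ≤ W :=
        (Real.log_le_log habs0 (le_max_right _ _)).trans (hW i₀)
      calc |(b i₀ : ℝ)| = Real.exp (Real.log |(b i₀ : ℝ)|) := (Real.exp_log habs0).symm
        _ ≤ Real.exp W := Real.exp_le_exp.mpr hlogb
    calc Real.exp (-W) = 1 / Real.exp W := by rw [Real.exp_neg, one_div]
      _ ≤ 1 / |(b i₀ : ℝ)| := one_div_le_one_div_of_le habs0 hle
      _ ≤ ‖((b i₀ : ℤ) : ℚ_[p])‖ := h1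
  have hkey : Real.exp (-(U + W)) < (p : ℝ) ^ (-padicValRat p ((∏ j, α j ^ b j) - 1)) := by
    rw [← hnorm, hnorm', show -(U + W) = -W + -U by ring, Real.exp_add]
    exact mul_lt_mul' hbθ hΛ₀' (Real.exp_pos _).le (lt_of_lt_of_le (Real.exp_pos _) hbθ)
  -- take logarithms
  have hlog := Real.log_lt_log (Real.exp_pos _) hkey
  rw [Real.log_exp, Real.log_zpow] at hlog
  push_cast at hlog
  nlinarith [hlog, hWU, hlp0]

end PadicCW77

end Literature.NumberTheory.Transcendental

end
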